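import Literature.Barriers.QuantumAdvantage.TensorNetworkContraction
import Mathlib.Combinatorics.SimpleGraph.Basic
import Mathlib.Algebra.BigOperators.Fin
import Mathlib.Tactic.DeriveFintype
import HarnessLib

/-!
# Barrier catalogue `QuantumAdvantage` — the circuit graph `G_C` of a quantum circuit (Markov–Shi §2, §5)

Companion to `TensorNetworkContraction.lean` (the Markov–Shi barrier). This file types the
**circuit graph** of a circuit `C : QCircuit G N` (Q2's gate lists), the object whose treewidth
governs Markov–Shi's simulation (Thm 1.1 / Thm 4.6), and the bags of the path decomposition in
the proof of their Prop. 5.1: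

"The graph of a quantum circuit `C`, denoted by `G_C`, is obtained from `C` as follows. Regard
each gate as a vertex, and for each input/output wire add a new vertex to the open edge of the
wire. Each wire segment can now be represented by an edge in the graph." [Markov–Shi, §2, p. 6]

* `CircuitNode T N` — the vertices: `input w`, `gate t` (`t < T` a position in the gate list),
  `output w`; `CircuitNode.pos` time-stamps them (`0`, `t + 1`, `T + 1`).
* `OnWire C w u` (the node lies on wire `w`), `Consecutive C w u v` (two nodes on wire `w` with
  no node of wire `w` strictly between them — a wire segment), `circuitGraph C` (Mathlib
  `SimpleGraph.fromRel` of "joined by a wire segment"; parallel segments, which arise when two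
  consecutive gates share two wires, collapse to one edge — immaterial for treewidth).
* The bags of §5: `Crosses σ i g` (the gate acts on wires on both sides of the cut after
  position `i` of the ordering `σ`; `QCircuit.cutLoadUnder σ C i` counts exactly these gates,
  `cutLoadUnder_eq_countP_crosses`), `crossNodes C σ i` (their nodes, `card_crossNodes`),
  `around C w j` (the at most two nodes of wire `w` adjacent to the time boundary `j | j+1`,
  `card_around_le_two`, the interval property `mem_around_of_mem_of_mem`), and the bag
  `bagAt C σ i j = crossNodes (i) ∪ crossNodes (i-1) ∪ around (σ⁻¹ i) j` with
  `card_bagAt_le : |bagAt| ≤ 2·cutParamUnder σ C + 2`.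

The path decomposition itself and the bound `treewidth (circuitGraph C) ≤ 2·cutParamUnder + 1`
are in `TensorNetworkContractionTreewidth.lean`.

## References

* [MarkovShi2008] I. L. Markov, Y. Shi, *Simulating quantum computation by contracting tensor
  networks*, SIAM J. Comput. 38 (2008) 963–981 (arXiv:quant-ph/0511069): §2 (the graph `G_C`,
  p. 6 of the arXiv version), §5 (proof of Prop. 5.1, p. 11). Read via
  `lit read paper:arxiv-quant-ph_0511069`.
-/

namespace Literature.Barriers.QuantumAdvantage

open Literature.Computability.Cryptography

/-- The vertices of the circuit graph of a circuit with `T` gates on `N` wires: one vertex per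
gate (indexed by its position in the gate list), one input vertex and one output vertex per
wire ("for each input/output wire add a new vertex to the open edge of the wire").
[cite: MarkovShi2008, §2 (the graph G_C)] -/
inductive CircuitNode (T N : ℕ)
  /-- The input end of wire `w`. -/
  | input (w : Fin N)
  /-- The `t`-th gate of the circuit. -/
  | gate (t : Fin T)
  /-- The output end of wire `w`. -/
  | output (w : Fin N)
  deriving DecidableEq, Fintype

namespace CircuitNode

variable {T N : ℕ}

/-- Time stamp of a node: inputs `0`, the `t`-th gate `t + 1`, outputs `T + 1`. [folklore] -/
def pos : CircuitNode T N → ℕ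
  | input _ => 0
  | gate t => (t : ℕ) + 1
  | output _ => T + 1

/-- Time stamps are at most `T + 1`. [folklore] -/
theorem pos_le (u : CircuitNode T N) : u.pos ≤ T + 1 := by
  cases u with
  | input w => simp [pos]
  | gate t => have := t.isLt; simp only [pos]; omega
  | output w => simp [pos]

/-- `gate` is injective. [folklore] -/
theorem gate_injective : Function.Injective (gate : Fin T → CircuitNode T N) :=
  fun a b h => by cases h; rfl

end CircuitNode

variable {G : QGateSet} {N : ℕ}

/-- `OnWire C w u`: the node `u` lies on wire `w` (an input/output end of `w`, or a gate acting
on `w`). [cite: MarkovShi2008, §2 (the graph G_C)] -/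
def OnWire (C : QCircuit G N) (w : Fin N) : CircuitNode C.gates.length N → Prop
  | .input w' => w' = w
  | .gate t => w ∈ (C.gates[(t : ℕ)]'t.isLt).wires
  | .output w' => w' = w

/-- `OnWire` is decidable (equality of wires, membership in a `Finset`). [folklore] -/
instance (C : QCircuit G N) (w : Fin N) : DecidablePred (OnWire C w) := fun u => by
  cases u <;> unfold OnWire <;> infer_instance

/-- Nodes on a common wire with equal time stamps are equal. [folklore] -/
theorem OnWire.eq_of_pos_eq {C : QCircuit G N} {w : Fin N} {u v : CircuitNode C.gates.length N}
    (hu : OnWire C w u) (hv : OnWire C w v) (h : u.pos = v.pos) : u = v := by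
  cases u with
  | input a =>
    cases v with
    | input b => simp only [OnWire] at hu hv; subst hu; subst hv; rfl
    | gate t => simp [CircuitNode.pos] at h
    | output b => simp [CircuitNode.pos] at h
  | gate s =>
    cases v with
    | input b => simp [CircuitNode.pos] at h
    | gate t => simp only [CircuitNode.pos, Nat.add_right_cancel_iff] at h; rw [Fin.ext h]
    | output b => have := s.isLt; simp only [CircuitNode.pos] at h; omega
  | output a =>
    cases v with
    | input b => simp [CircuitNode.pos] at h
    | gate t => have := t.isLt; simp only [CircuitNode.pos] at h; omega
    | output b => simp only [OnWire] at hu hv; subst hu; subst hv; rfl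

/-- `Consecutive C w u v`: `u` and `v` lie on wire `w`, `u` strictly earlier, and no node of wire
`w` lies strictly between them — i.e. a wire segment of `w` joins `u` to `v`.
[cite: MarkovShi2008, §2 (the graph G_C)] -/
def Consecutive (C : QCircuit G N) (w : Fin N) (u v : CircuitNode C.gates.length N) : Prop :=
  OnWire C w u ∧ OnWire C w v ∧ u.pos < v.pos ∧ ∀ z, OnWire C w z → z.pos ≤ u.pos ∨ v.pos ≤ z.pos

/-- **The circuit graph `G_C`** of a circuit (Markov–Shi §2): vertices `CircuitNode`, two
vertices adjacent iff some wire segment joins them. As a simple graph: parallel wire segments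
between the same two gates give a single edge (treewidth does not see parallel edges).
[cite: MarkovShi2008, §2 (the graph G_C)] -/
def circuitGraph (C : QCircuit G N) : SimpleGraph (CircuitNode C.gates.length N) :=
  SimpleGraph.fromRel fun u v => ∃ w, Consecutive C w u v

/-- Adjacency in the circuit graph. [cite: MarkovShi2008, §2 (the graph G_C)] -/
theorem circuitGraph_adj {C : QCircuit G N} {u v : CircuitNode C.gates.length N} :
    (circuitGraph C).Adj u v ↔ u ≠ v ∧ ((∃ w, Consecutive C w u v) ∨ ∃ w, Consecutive C w v u) :=
  SimpleGraph.fromRel_adj _ _ _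

/-! ### The nodes of a wire around a time boundary -/

/-- `LastBefore C w j u`: `u` is the last node of wire `w` with time stamp `≤ j`. [folklore] -/
def LastBefore (C : QCircuit G N) (w : Fin N) (j : ℕ) (u : CircuitNode C.gates.length N) : Prop :=
  OnWire C w u ∧ u.pos ≤ j ∧ ∀ z, OnWire C w z → z.pos ≤ j → z.pos ≤ u.pos

/-- `FirstAfter C w j u`: `u` is the first node of wire `w` with time stamp `> j`. [folklore] -/
def FirstAfter (C : QCircuit G N) (w : Fin N) (j : ℕ) (u : CircuitNode C.gates.length N) : Prop :=
  OnWire C w u ∧ j < u.pos ∧ ∀ z, OnWire C w z → j < z.pos → u.pos ≤ z.pos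

open scoped Classical in
/-- The nodes of wire `w` **around the time boundary** between stamps `j` and `j + 1`: the last
node with stamp `≤ j` and the first node with stamp `> j` (the two ends of the wire segment of
`w` crossing that boundary, when there is one). [cite: MarkovShi2008, §5 (proof of Prop 5.1)] -/
noncomputable def around (C : QCircuit G N) (w : Fin N) (j : ℕ) :
    Finset (CircuitNode C.gates.length N) :=
  Finset.univ.filter fun u => LastBefore C w j u ∨ FirstAfter C w j u

/-- Membership in `around`. [folklore] -/
theorem mem_around {C : QCircuit G N} {w : Fin N} {j : ℕ} {u : CircuitNode C.gates.length N} :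
    u ∈ around C w j ↔ LastBefore C w j u ∨ FirstAfter C w j u := by
  simp [around]

/-- A node of `around C w j` lies on wire `w`. [folklore] -/
theorem onWire_of_mem_around {C : QCircuit G N} {w : Fin N} {j : ℕ}
    {u : CircuitNode C.gates.length N} (h : u ∈ around C w j) : OnWire C w u := by
  rcases mem_around.1 h with h | h <;> exact h.1

/-- `around C w j` has at most two nodes (time stamps are injective along a wire). [folklore] -/
theorem card_around_le_two (C : QCircuit G N) (w : Fin N) (j : ℕ) : (around C w j).card ≤ 2 := by
  classical
  have h1 : (Finset.univ.filter fun u => LastBefore C w j u).card ≤ 1 :=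
    Finset.card_le_one.2 fun a ha b hb => by
      simp only [Finset.mem_filter, Finset.mem_univ, true_and] at ha hb
      exact ha.1.eq_of_pos_eq hb.1 (le_antisymm (hb.2.2 a ha.1 ha.2.1) (ha.2.2 b hb.1 hb.2.1))
  have h2 : (Finset.univ.filter fun u => FirstAfter C w j u).card ≤ 1 :=
    Finset.card_le_one.2 fun a ha b hb => by
      simp only [Finset.mem_filter, Finset.mem_univ, true_and] at ha hb
      exact ha.1.eq_of_pos_eq hb.1 (le_antisymm (ha.2.2 b hb.1 hb.2.1) (hb.2.2 a ha.1 ha.2.1))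
  have h3 : around C w j = (Finset.univ.filter fun u => LastBefore C w j u) ∪
      (Finset.univ.filter fun u => FirstAfter C w j u) := by
    ext u
    simp [mem_around]
  rw [h3]
  exact (Finset.card_union_le _ _).trans (by omega)

/-- **Interval property**: a node in `around C w j₁` and in `around C w j₂` is in `around C w j`
for every `j₁ ≤ j ≤ j₂`. [folklore] -/
theorem mem_around_of_mem_of_mem {C : QCircuit G N} {w : Fin N} {j₁ j j₂ : ℕ}
    {u : CircuitNode C.gates.length N} (h₁ : u ∈ around C w j₁) (h₂ : u ∈ around C w j₂)
    (hj₁ : j₁ ≤ j) (hj₂ : j ≤ j₂) : u ∈ around C w j := by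
  rw [mem_around] at h₁ h₂ ⊢
  by_cases hpu : u.pos ≤ j
  · left
    rcases h₂ with ⟨hw, _, hmax⟩ | ⟨_, hp2, _⟩
    · exact ⟨hw, hpu, fun z hz hzj => hmax z hz (hzj.trans hj₂)⟩
    · exfalso; omega
  · right
    rw [not_le] at hpu
    rcases h₁ with ⟨_, hp1, _⟩ | ⟨hw, _, hmin⟩
    · exfalso; omega
    · exact ⟨hw, hpu, fun z hz hjz => hmin z hz (by omega)⟩

/-- Every node of wire `w` lies in `around C w j` for some boundary `j ≤ T`. [folklore] -/
theorem exists_mem_around {C : QCircuit G N} {w : Fin N} {u : CircuitNode C.gates.length N}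
    (hu : OnWire C w u) : ∃ j ≤ C.gates.length, u ∈ around C w j := by
  by_cases h : u.pos ≤ C.gates.length
  · exact ⟨u.pos, h, mem_around.2 (Or.inl ⟨hu, le_rfl, fun z _ hz => hz⟩)⟩
  · refine ⟨C.gates.length, le_rfl, mem_around.2 (Or.inr ⟨hu, by omega, fun z _ hjz => ?_⟩)⟩
    have := z.pos_le
    have := u.pos_le
    omega

/-- The two ends of a wire segment lie in `around` at the stamp of the earlier end. [folklore] -/
theorem Consecutive.ends_mem_around {C : QCircuit G N} {w : Fin N} {u v : CircuitNode C.gates.length N}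
    (h : Consecutive C w u v) : u ∈ around C w u.pos ∧ v ∈ around C w u.pos :=
  ⟨mem_around.2 (Or.inl ⟨h.1, le_rfl, fun _ _ hz => hz⟩),
   mem_around.2 (Or.inr ⟨h.2.1, h.2.2.1, fun z hz hjz =>
    (h.2.2.2 z hz).resolve_left (by omega)⟩)⟩

/-! ### Gates crossing a cut -/

/-- `Crosses σ i g`: the gate `g` acts on some wire at position `≤ i` and on some wire at
position `> i` of the ordering `σ` — it crosses the cut after position `i` (Markov–Shi's "gates
that act on some qubits `j` and `j'` with `j ≤ i < j'`"). [cite: MarkovShi2008, §5 (Prop 5.1)] -/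
def Crosses (σ : Fin N ≃ Fin N) (i : ℕ) (g : QGate G N) : Prop :=
  (∃ j ∈ g.wires, ((σ j : Fin N) : ℕ) ≤ i) ∧ (∃ j' ∈ g.wires, i < ((σ j' : Fin N) : ℕ))

/-- `Crosses` is decidable (bounded quantifiers over a `Finset`); this is the instance under
which `QCircuit.cutLoadUnder` counts. [folklore] -/
instance (σ : Fin N ≃ Fin N) (i : ℕ) : DecidablePred (Crosses (G := G) σ i) := fun g => by
  unfold Crosses; infer_instance

/-- `QCircuit.cutLoadUnder` counts the gates crossing the cut (definitional).
[cite: MarkovShi2008, §5 (Prop 5.1)] -/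
theorem cutLoadUnder_eq_countP_crosses (σ : Fin N ≃ Fin N) (C : QCircuit G N) (i : ℕ) :
    C.cutLoadUnder σ i = C.gates.countP fun g => decide (Crosses σ i g) := by
  unfold QCircuit.cutLoadUnder Crosses
  congr

/-- Counting along a list through its positions: the number of positions `t` with `p l[t]` is
`l.countP p`. [folklore] -/
theorem card_filter_univ_fin_eq_countP {α : Type*} (l : List α) (p : α → Prop) [DecidablePred p] :
    (Finset.univ.filter fun t : Fin l.length => p l[(t : ℕ)]).card =
      l.countP fun x => decide (p x) := by
  rw [Finset.card_filter, Fin.sum_univ_fun_getElem l fun x => if p x then 1 else 0]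
  induction l with
  | nil => simp
  | cons a l ih =>
    rw [List.map_cons, List.sum_cons, List.countP_cons, ih]
    by_cases hp : p a <;> simp [hp, Nat.add_comm]

/-- The nodes of the gates crossing the cut after position `i`: Markov–Shi's bag `B_i`.
[cite: MarkovShi2008, §5 (proof of Prop 5.1)] -/
noncomputable def crossNodes (C : QCircuit G N) (σ : Fin N ≃ Fin N) (i : ℕ) :
    Finset (CircuitNode C.gates.length N) :=
  (Finset.univ.filter fun t : Fin C.gates.length => Crosses σ i C.gates[(t : ℕ)]).map
    ⟨CircuitNode.gate, CircuitNode.gate_injective⟩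

/-- Membership in `crossNodes`: only gate nodes, and exactly those crossing the cut. [folklore] -/
theorem mem_crossNodes {C : QCircuit G N} {σ : Fin N ≃ Fin N} {i : ℕ}
    {u : CircuitNode C.gates.length N} :
    u ∈ crossNodes C σ i ↔ ∃ t : Fin C.gates.length, u = .gate t ∧ Crosses σ i C.gates[(t : ℕ)] := by
  simp only [crossNodes, Finset.mem_map, Finset.mem_filter, Finset.mem_univ, true_and,
    Function.Embedding.coeFn_mk]
  constructor
  · rintro ⟨t, ht, rfl⟩; exact ⟨t, rfl, ht⟩
  · rintro ⟨t, rfl, ht⟩; exact ⟨t, ht, rfl⟩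

/-- A gate node lies in `crossNodes C σ i` iff its gate crosses the cut. [folklore] -/
theorem gate_mem_crossNodes {C : QCircuit G N} {σ : Fin N ≃ Fin N} {i : ℕ}
    {t : Fin C.gates.length} :
    CircuitNode.gate t ∈ crossNodes C σ i ↔ Crosses σ i C.gates[(t : ℕ)] := by
  rw [mem_crossNodes]
  constructor
  · rintro ⟨t', ht', h⟩; cases ht'; exact h
  · exact fun h => ⟨t, rfl, h⟩

/-- `|B_i| = cutLoadUnder σ C i`: the bag of the cut after position `i` has exactly as many
nodes as gates cross that cut. [cite: MarkovShi2008, §5 (proof of Prop 5.1: "|B_i| ≤ r")] -/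
theorem card_crossNodes (C : QCircuit G N) (σ : Fin N ≃ Fin N) (i : ℕ) :
    (crossNodes C σ i).card = C.cutLoadUnder σ i := by
  rw [crossNodes, Finset.card_map, card_filter_univ_fin_eq_countP, cutLoadUnder_eq_countP_crosses]

/-- `|B_i| ≤ r` for cut positions inside the register. [cite: MarkovShi2008, §5 (proof of Prop 5.1)] -/
theorem card_crossNodes_le (C : QCircuit G N) (σ : Fin N ≃ Fin N) {i : ℕ} (hi : i < N) :
    (crossNodes C σ i).card ≤ C.cutParamUnder σ := by
  rw [card_crossNodes]
  exact Finset.le_sup (f := fun i : Fin N => C.cutLoadUnder σ i) (Finset.mem_univ ⟨i, hi⟩)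

/-! ### The bags of the path decomposition -/

/-- **The bag at (position `i`, time boundary `j`)**: the gates crossing the cut after position
`i` or the cut after position `i - 1` (Markov–Shi's `B_{i-1} ∪ B_i`; at `i = 0` both are `B_0`),
together with the (at most two) nodes of the wire at position `i` around the boundary `j | j+1`.
[cite: MarkovShi2008, §5 (proof of Prop 5.1)] -/
noncomputable def bagAt (C : QCircuit G N) (σ : Fin N ≃ Fin N) (i : Fin N) (j : ℕ) :
    Finset (CircuitNode C.gates.length N) :=
  crossNodes C σ i ∪ crossNodes C σ ((i : ℕ) - 1) ∪ around C (σ.symm i) j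

/-- Membership in a bag. [folklore] -/
theorem mem_bagAt {C : QCircuit G N} {σ : Fin N ≃ Fin N} {i : Fin N} {j : ℕ}
    {u : CircuitNode C.gates.length N} :
    u ∈ bagAt C σ i j ↔
      u ∈ crossNodes C σ i ∨ u ∈ crossNodes C σ ((i : ℕ) - 1) ∨ u ∈ around C (σ.symm i) j := by
  simp [bagAt]

/-- **Width of the bags**: `|bagAt C σ i j| ≤ 2·r + 2` with `r = cutParamUnder σ C`.
[cite: MarkovShi2008, §5 (proof of Prop 5.1: "|B_i| ≤ r")] -/
theorem card_bagAt_le (C : QCircuit G N) (σ : Fin N ≃ Fin N) (i : Fin N) (j : ℕ) :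
    (bagAt C σ i j).card ≤ 2 * C.cutParamUnder σ + 2 := by
  have hi := i.isLt
  have h1 := card_crossNodes_le C σ hi
  have h2 := card_crossNodes_le C σ (i := (i : ℕ) - 1) (by omega)
  have h3 := card_around_le_two C (σ.symm i) j
  unfold bagAt
  exact (Finset.card_union_le _ _).trans ((Nat.add_le_add (Finset.card_union_le _ _) h3).trans
    (by omega))

end Literature.Barriers.QuantumAdvantage
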